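import Mathlib
import Summits.Ventures.PercRepro.TriangleCapRowJArith

/-!
# PercRepro — EVERY ROW `r = a + j`: THE ARITHMETIC OF THE VERTEX-BOUND MIXED READS (p3, gen 48; part 202e)

`D − z ⊆ K(A′, A′ᶜ)` on `(k − 1, a, d + j)`, `d ≥ 3`, with `t` in-side and `s₀ = d − t` off-side neighbours of `z`; the
missing graph of `D − z` has `s = d + j` pairs, `x ≥ t − 1` of them at an off-side neighbour `w₀` (`K₄⁻`); the vertex
bound `Σ h² ≤ s (s + 1) − 2 (s − x)(x − 1)` is concave in `x`, so it suffices to read it at `x = t − 1` and at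
`x = min (s, a)`. With `T = Σ_{w ∼ z} deg_{D−z} w`: for a single off-side neighbour (`t = d − 1`) the in-side
neighbours are at `≤ k − a − 2` (no vertex at the cap) and `w₀` at `a − x`; for `s₀ ≥ 2` the in-side neighbours are
at `≤ k − a − s₀` (`inside_deg_bound`) and the other off-side ones at `≤ a + 1 − t` (`offside_deg_bound`). Against the
`(j + 1)`-broom target, `a = d + 1 + u`, `d = v + 3`, `k = 3a + j + c` (and `t = y + 1`, `s₀ = z + 2`, `v = y + z`):
slacks `2uv + 6v + 4u − 4j + 2` (`one_lo`, `≥ 2uv + 2v + 6`), `2v (u − j) + 2v + 4u − 2j + 6` (`one_hi_s`),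
`2u (j − u − 1) + 2j + 2` (`one_hi_a`), and the three `two_*` polynomials of mining/p3/g48/rowjslack.py — all
non-negative on their ranges (`j + 5 ≤ a`, `y ≤ v`). Axioms: standard.
-/

namespace PercRepro

namespace TriangleCap

namespace C047

/-- Single off-side neighbour, `x = t − 1 = d − 2`. -/
theorem rowJ_one_lo (a j d x k m' S' T : ℕ) (ha : j + 5 ≤ a) (hk : 3 * a + j ≤ k) (hd3 : 3 ≤ d) (hda : d + 1 ≤ a)
    (hx : x + 2 = d) (hmd : m' + d + (a + j) = a * (k - a))
    (hST : S' + 2 * T + (d + j) * (k - 1 - 1 - (d + j)) + (2 * ((d + j - x) * (x - 1)) + 2 * x) ≤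
      m' * (k - 1) + 2 * ((d - 1) * (k - a - 2)) + 2 * a) :
    S' + 2 * T + d + d * d + (a + j) * (k - 1 - (a + j)) + (2 * (k - a - 3) + 2 * j * (a - 2)) ≤ (m' + d) * k := by
  obtain ⟨v, rfl⟩ : ∃ v, d = v + 3 := ⟨d - 3, by omega⟩
  have hxv : x = v + 1 := by omega
  subst hxv
  obtain ⟨u, rfl⟩ : ∃ u, a = v + 3 + 1 + u := ⟨a - (v + 3 + 1), by omega⟩
  obtain ⟨c, rfl⟩ : ∃ c, k = 3 * (v + 3 + 1 + u) + j + c := ⟨k - (3 * (v + 3 + 1 + u) + j), by omega⟩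
  have hj : j + 1 ≤ v + u := by omega
  have e1 : 3 * (v + 3 + 1 + u) + j + c - 1 - 1 - (v + 3 + j) = 2 * v + 7 + 3 * u + c := by omega
  have e2 : v + 3 + j - (v + 1) = j + 2 := by omega
  have e3 : v + 1 - 1 = v := by omega
  have e4 : 3 * (v + 3 + 1 + u) + j + c - 1 = 3 * v + 11 + 3 * u + j + c := by omega
  have e5 : v + 3 - 1 = v + 2 := by omega
  have e6 : 3 * (v + 3 + 1 + u) + j + c - (v + 3 + 1 + u) - 2 = 2 * v + 6 + 2 * u + j + c := by omega
  have e8 : 3 * (v + 3 + 1 + u) + j + c - 1 - (v + 3 + 1 + u + j) = 2 * v + 7 + 2 * u + c := by omega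
  have e9 : 3 * (v + 3 + 1 + u) + j + c - (v + 3 + 1 + u) - 3 = 2 * v + 5 + 2 * u + j + c := by omega
  have e10 : v + 3 + 1 + u - 2 = v + 2 + u := by omega
  have e11 : 3 * (v + 3 + 1 + u) + j + c - (v + 3 + 1 + u) = 2 * v + 8 + 2 * u + j + c := by omega
  rw [e1, e2, e3, e4] at hST
  rw [e5, e6] at hST
  rw [e8, e9, e10]
  rw [e11] at hmd
  linarith only [hST, hmd, hj, Nat.zero_le (u * v)]

/-- Single off-side neighbour, `x = s = d + j ≤ a`. -/
theorem rowJ_one_hi_s (a j d x k m' S' T : ℕ) (ha : j + 5 ≤ a) (hk : 3 * a + j ≤ k) (hd3 : 3 ≤ d) (hda : d + 1 ≤ a)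
    (hsa : d + j ≤ a) (hx : x = d + j) (hmd : m' + d + (a + j) = a * (k - a))
    (hST : S' + 2 * T + (d + j) * (k - 1 - 1 - (d + j)) + (2 * ((d + j - x) * (x - 1)) + 2 * x) ≤
      m' * (k - 1) + 2 * ((d - 1) * (k - a - 2)) + 2 * a) :
    S' + 2 * T + d + d * d + (a + j) * (k - 1 - (a + j)) + (2 * (k - a - 3) + 2 * j * (a - 2)) ≤ (m' + d) * k := by
  subst hx
  obtain ⟨v, rfl⟩ : ∃ v, d = v + 3 := ⟨d - 3, by omega⟩
  obtain ⟨u, rfl⟩ : ∃ u, a = v + 3 + 1 + u := ⟨a - (v + 3 + 1), by omega⟩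
  obtain ⟨c, rfl⟩ : ∃ c, k = 3 * (v + 3 + 1 + u) + j + c := ⟨k - (3 * (v + 3 + 1 + u) + j), by omega⟩
  have hju : j ≤ u + 1 := by omega
  have e1 : 3 * (v + 3 + 1 + u) + j + c - 1 - 1 - (v + 3 + j) = 2 * v + 7 + 3 * u + c := by omega
  have e2 : v + 3 + j - (v + 3 + j) = 0 := by omega
  have e4 : 3 * (v + 3 + 1 + u) + j + c - 1 = 3 * v + 11 + 3 * u + j + c := by omega
  have e5 : v + 3 - 1 = v + 2 := by omega
  have e6 : 3 * (v + 3 + 1 + u) + j + c - (v + 3 + 1 + u) - 2 = 2 * v + 6 + 2 * u + j + c := by omega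
  have e8 : 3 * (v + 3 + 1 + u) + j + c - 1 - (v + 3 + 1 + u + j) = 2 * v + 7 + 2 * u + c := by omega
  have e9 : 3 * (v + 3 + 1 + u) + j + c - (v + 3 + 1 + u) - 3 = 2 * v + 5 + 2 * u + j + c := by omega
  have e10 : v + 3 + 1 + u - 2 = v + 2 + u := by omega
  have e11 : 3 * (v + 3 + 1 + u) + j + c - (v + 3 + 1 + u) = 2 * v + 8 + 2 * u + j + c := by omega
  rw [e1, e2, e4] at hST
  rw [e5, e6] at hST
  rw [e8, e9, e10]
  rw [e11] at hmd
  have hjv : j * v ≤ (u + 1) * v := Nat.mul_le_mul_right v hju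
  simp only [zero_mul, mul_zero] at hST
  linarith only [hST, hmd, hjv, hju, Nat.zero_le (u * v)]

/-- Single off-side neighbour, `x = a ≤ s = d + j` (`w₀` isolated in `D − z`). -/
theorem rowJ_one_hi_a (a j d x k m' S' T : ℕ) (ha : j + 5 ≤ a) (hk : 3 * a + j ≤ k) (hd3 : 3 ≤ d) (hda : d + 1 ≤ a)
    (has : a ≤ d + j) (hx : x = a) (hmd : m' + d + (a + j) = a * (k - a))
    (hST : S' + 2 * T + (d + j) * (k - 1 - 1 - (d + j)) + (2 * ((d + j - x) * (x - 1)) + 2 * x) ≤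
      m' * (k - 1) + 2 * ((d - 1) * (k - a - 2)) + 2 * a) :
    S' + 2 * T + d + d * d + (a + j) * (k - 1 - (a + j)) + (2 * (k - a - 3) + 2 * j * (a - 2)) ≤ (m' + d) * k := by
  rw [hx] at hST
  obtain ⟨v, rfl⟩ : ∃ v, d = v + 3 := ⟨d - 3, by omega⟩
  obtain ⟨u, rfl⟩ : ∃ u, a = v + 3 + 1 + u := ⟨a - (v + 3 + 1), by omega⟩
  obtain ⟨g, rfl⟩ : ∃ g, j = u + 1 + g := ⟨j - (u + 1), by omega⟩
  obtain ⟨c, rfl⟩ : ∃ c, k = 3 * (v + 3 + 1 + u) + (u + 1 + g) + c :=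
    ⟨k - (3 * (v + 3 + 1 + u) + (u + 1 + g)), by omega⟩
  have e1 : 3 * (v + 3 + 1 + u) + (u + 1 + g) + c - 1 - 1 - (v + 3 + (u + 1 + g)) = 2 * v + 7 + 3 * u + c := by
    omega
  have e2 : v + 3 + (u + 1 + g) - (v + 3 + 1 + u) = g := by omega
  have e3 : v + 3 + 1 + u - 1 = v + 3 + u := by omega
  have e4 : 3 * (v + 3 + 1 + u) + (u + 1 + g) + c - 1 = 3 * v + 12 + 4 * u + g + c := by omega
  have e5 : v + 3 - 1 = v + 2 := by omega
  have e6 : 3 * (v + 3 + 1 + u) + (u + 1 + g) + c - (v + 3 + 1 + u) - 2 = 2 * v + 7 + 3 * u + g + c := by omega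
  have e8 : 3 * (v + 3 + 1 + u) + (u + 1 + g) + c - 1 - (v + 3 + 1 + u + (u + 1 + g)) = 2 * v + 7 + 2 * u + c := by
    omega
  have e9 : 3 * (v + 3 + 1 + u) + (u + 1 + g) + c - (v + 3 + 1 + u) - 3 = 2 * v + 6 + 3 * u + g + c := by omega
  have e10 : v + 3 + 1 + u - 2 = v + 2 + u := by omega
  have e11 : 3 * (v + 3 + 1 + u) + (u + 1 + g) + c - (v + 3 + 1 + u) = 2 * v + 9 + 3 * u + g + c := by omega
  rw [e1, e2, e3, e4] at hST
  rw [e5, e6] at hST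
  rw [e8, e9, e10]
  rw [e11] at hmd
  linarith only [hST, hmd, Nat.zero_le (u * g), Nat.zero_le (u * v)]

/-- `s₀ ≥ 2` off-side neighbours, `x = t − 1`. -/
theorem rowJ_two_lo (a j d t s₀ x k m' S' T : ℕ) (ha : j + 5 ≤ a) (hk : 3 * a + j ≤ k) (hd3 : 3 ≤ d)
    (hda : d + 1 ≤ a) (hts : t + s₀ = d) (ht1 : 1 ≤ t) (hs₀ : 2 ≤ s₀) (hx : x + 1 = t)
    (hmd : m' + d + (a + j) = a * (k - a))
    (hST : S' + 2 * T + (d + j) * (k - 1 - 1 - (d + j)) + (2 * ((d + j - x) * (x - 1)) + 2 * x) ≤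
      m' * (k - 1) + 2 * (t * (k - a - s₀)) + 2 * a + 2 * ((s₀ - 1) * (a + 1 - t))) :
    S' + 2 * T + d + d * d + (a + j) * (k - 1 - (a + j)) + (2 * (k - a - 3) + 2 * j * (a - 2)) ≤ (m' + d) * k := by
  obtain ⟨z, rfl⟩ : ∃ z, s₀ = z + 2 := ⟨s₀ - 2, by omega⟩
  rcases Nat.lt_or_ge t 2 with ht2 | ht2
  · -- `t = 1`, `x = 0`: the bare closed form, `d = z + 3`
    have ht : t = 1 := by omega
    subst ht
    have hx0 : x = 0 := by omega
    subst hx0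
    have hd : d = z + 3 := by omega
    subst hd
    obtain ⟨u, rfl⟩ : ∃ u, a = z + 3 + 1 + u := ⟨a - (z + 3 + 1), by omega⟩
    obtain ⟨c, rfl⟩ : ∃ c, k = 3 * (z + 3 + 1 + u) + j + c := ⟨k - (3 * (z + 3 + 1 + u) + j), by omega⟩
    have hj : j + 1 ≤ z + u := by omega
    have e1 : 3 * (z + 3 + 1 + u) + j + c - 1 - 1 - (z + 3 + j) = 2 * z + 7 + 3 * u + c := by omega
    have e2 : (z + 3 + j - 0) * (0 - 1) = 0 := by omega
    have e4 : 3 * (z + 3 + 1 + u) + j + c - 1 = 3 * z + 11 + 3 * u + j + c := by omega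
    have e6 : 3 * (z + 3 + 1 + u) + j + c - (z + 3 + 1 + u) - (z + 2) = z + 6 + 2 * u + j + c := by omega
    have e7' : z + 2 - 1 = z + 1 := by omega
    have e7'' : z + 3 + 1 + u + 1 - 1 = z + 4 + u := by omega
    have e8 : 3 * (z + 3 + 1 + u) + j + c - 1 - (z + 3 + 1 + u + j) = 2 * z + 7 + 2 * u + c := by omega
    have e9 : 3 * (z + 3 + 1 + u) + j + c - (z + 3 + 1 + u) - 3 = 2 * z + 5 + 2 * u + j + c := by omega
    have e10 : z + 3 + 1 + u - 2 = z + 2 + u := by omega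
    have e11 : 3 * (z + 3 + 1 + u) + j + c - (z + 3 + 1 + u) = 2 * z + 8 + 2 * u + j + c := by omega
    rw [e1, e2, e4] at hST
    rw [e6, e7', e7''] at hST
    rw [e8, e9, e10]
    rw [e11] at hmd
    linarith only [hST, hmd, hj, Nat.zero_le (u * z), Nat.zero_le (z * c), Nat.zero_le (z * z)]
  · obtain ⟨y, rfl⟩ : ∃ y, t = y + 2 := ⟨t - 2, by omega⟩
    have hxy : x = y + 1 := by omega
    subst hxy
    have hd : d = y + z + 4 := by omega
    subst hd
    obtain ⟨u, rfl⟩ : ∃ u, a = y + z + 4 + 1 + u := ⟨a - (y + z + 4 + 1), by omega⟩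
    obtain ⟨c, rfl⟩ : ∃ c, k = 3 * (y + z + 4 + 1 + u) + j + c := ⟨k - (3 * (y + z + 4 + 1 + u) + j), by omega⟩
    have hj : j + 1 ≤ y + z + u + 1 := by omega
    have e1 : 3 * (y + z + 4 + 1 + u) + j + c - 1 - 1 - (y + z + 4 + j) = 2 * y + 2 * z + 9 + 3 * u + c := by
      omega
    have e2 : y + z + 4 + j - (y + 1) = z + 3 + j := by omega
    have e3 : y + 1 - 1 = y := by omega
    have e4 : 3 * (y + z + 4 + 1 + u) + j + c - 1 = 3 * y + 3 * z + 14 + 3 * u + j + c := by omega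
    have e6 : 3 * (y + z + 4 + 1 + u) + j + c - (y + z + 4 + 1 + u) - (z + 2) = 2 * y + z + 8 + 2 * u + j + c := by
      omega
    have e7' : z + 2 - 1 = z + 1 := by omega
    have e7'' : y + z + 4 + 1 + u + 1 - (y + 2) = z + 4 + u := by omega
    have e8 : 3 * (y + z + 4 + 1 + u) + j + c - 1 - (y + z + 4 + 1 + u + j) = 2 * y + 2 * z + 9 + 2 * u + c := by
      omega
    have e9 : 3 * (y + z + 4 + 1 + u) + j + c - (y + z + 4 + 1 + u) - 3 = 2 * y + 2 * z + 7 + 2 * u + j + c := by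
      omega
    have e10 : y + z + 4 + 1 + u - 2 = y + z + 3 + u := by omega
    have e11 : 3 * (y + z + 4 + 1 + u) + j + c - (y + z + 4 + 1 + u) = 2 * y + 2 * z + 10 + 2 * u + j + c := by
      omega
    rw [e1, e2, e3, e4] at hST
    rw [e6, e7', e7''] at hST
    rw [e8, e9, e10]
    rw [e11] at hmd
    have hyz : y + 1 ≤ y + 1 + z := by omega
    have h1 : (y + 1) * (y + 1) ≤ (y + 1) * (y + 1 + z) := Nat.mul_le_mul_left _ hyz
    have h2 : c * (y + 1) ≤ c * (y + 1 + z) := Nat.mul_le_mul_left _ hyz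
    have h3 : u * (y + 1) ≤ u * (y + 1 + z) := Nat.mul_le_mul_left _ hyz
    linarith only [hST, hmd, hj, h1, h2, h3, Nat.zero_le (u * z), Nat.zero_le (z * c), Nat.zero_le (z * z),
      Nat.zero_le (y * z), Nat.zero_le (u * y)]

/-- `s₀ ≥ 2` off-side neighbours, `x = s = d + j ≤ a`. -/
theorem rowJ_two_hi_s (a j d t s₀ x k m' S' T : ℕ) (ha : j + 5 ≤ a) (hk : 3 * a + j ≤ k) (hd3 : 3 ≤ d)
    (hda : d + 1 ≤ a) (hts : t + s₀ = d) (ht1 : 1 ≤ t) (hs₀ : 2 ≤ s₀) (hsa : d + j ≤ a) (hx : x = d + j)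
    (hmd : m' + d + (a + j) = a * (k - a))
    (hST : S' + 2 * T + (d + j) * (k - 1 - 1 - (d + j)) + (2 * ((d + j - x) * (x - 1)) + 2 * x) ≤
      m' * (k - 1) + 2 * (t * (k - a - s₀)) + 2 * a + 2 * ((s₀ - 1) * (a + 1 - t))) :
    S' + 2 * T + d + d * d + (a + j) * (k - 1 - (a + j)) + (2 * (k - a - 3) + 2 * j * (a - 2)) ≤ (m' + d) * k := by
  subst hx
  obtain ⟨y, rfl⟩ : ∃ y, t = y + 1 := ⟨t - 1, by omega⟩
  obtain ⟨z, rfl⟩ : ∃ z, s₀ = z + 2 := ⟨s₀ - 2, by omega⟩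
  obtain ⟨v, rfl⟩ : ∃ v, d = v + 3 := ⟨d - 3, by omega⟩
  have hv : v = y + z := by omega
  subst hv
  obtain ⟨u, rfl⟩ : ∃ u, a = y + z + 3 + 1 + u := ⟨a - (y + z + 3 + 1), by omega⟩
  obtain ⟨c, rfl⟩ : ∃ c, k = 3 * (y + z + 3 + 1 + u) + j + c := ⟨k - (3 * (y + z + 3 + 1 + u) + j), by omega⟩
  have hju : j ≤ u + 1 := by omega
  have e1 : 3 * (y + z + 3 + 1 + u) + j + c - 1 - 1 - (y + z + 3 + j) = 2 * y + 2 * z + 7 + 3 * u + c := by omega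
  have e2 : y + z + 3 + j - (y + z + 3 + j) = 0 := by omega
  have e4 : 3 * (y + z + 3 + 1 + u) + j + c - 1 = 3 * y + 3 * z + 11 + 3 * u + j + c := by omega
  have e6 : 3 * (y + z + 3 + 1 + u) + j + c - (y + z + 3 + 1 + u) - (z + 2) = 2 * y + z + 6 + 2 * u + j + c := by
    omega
  have e7' : z + 2 - 1 = z + 1 := by omega
  have e7'' : y + z + 3 + 1 + u + 1 - (y + 1) = z + 4 + u := by omega
  have e8 : 3 * (y + z + 3 + 1 + u) + j + c - 1 - (y + z + 3 + 1 + u + j) = 2 * y + 2 * z + 7 + 2 * u + c := by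
    omega
  have e9 : 3 * (y + z + 3 + 1 + u) + j + c - (y + z + 3 + 1 + u) - 3 = 2 * y + 2 * z + 5 + 2 * u + j + c := by
    omega
  have e10 : y + z + 3 + 1 + u - 2 = y + z + 2 + u := by omega
  have e11 : 3 * (y + z + 3 + 1 + u) + j + c - (y + z + 3 + 1 + u) = 2 * y + 2 * z + 8 + 2 * u + j + c := by omega
  rw [e1, e2, e4] at hST
  rw [e6, e7', e7''] at hST
  rw [e8, e9, e10]
  rw [e11] at hmd
  simp only [zero_mul, mul_zero] at hST
  have hyz : y ≤ y + z := by omega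
  have h1 : y * y ≤ y * (y + z) := Nat.mul_le_mul_left _ hyz
  have h2 : c * y ≤ c * (y + z) := Nat.mul_le_mul_left _ hyz
  have h3 : u * y ≤ u * (y + z) := Nat.mul_le_mul_left _ hyz
  have h4 : j * y ≤ (u + 1) * y := Nat.mul_le_mul_right _ hju
  linarith only [hST, hmd, hju, h1, h2, h3, h4, Nat.zero_le (u * z), Nat.zero_le (z * c), Nat.zero_le (z * z),
    Nat.zero_le (y * z)]

/-- `s₀ ≥ 2` off-side neighbours, `x = a ≤ s = d + j`. -/
theorem rowJ_two_hi_a (a j d t s₀ x k m' S' T : ℕ) (ha : j + 5 ≤ a) (hk : 3 * a + j ≤ k) (hd3 : 3 ≤ d)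
    (hda : d + 1 ≤ a) (hts : t + s₀ = d) (ht1 : 1 ≤ t) (hs₀ : 2 ≤ s₀) (has : a ≤ d + j) (hx : x = a)
    (hmd : m' + d + (a + j) = a * (k - a))
    (hST : S' + 2 * T + (d + j) * (k - 1 - 1 - (d + j)) + (2 * ((d + j - x) * (x - 1)) + 2 * x) ≤
      m' * (k - 1) + 2 * (t * (k - a - s₀)) + 2 * a + 2 * ((s₀ - 1) * (a + 1 - t))) :
    S' + 2 * T + d + d * d + (a + j) * (k - 1 - (a + j)) + (2 * (k - a - 3) + 2 * j * (a - 2)) ≤ (m' + d) * k := by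
  rw [hx] at hST
  obtain ⟨y, rfl⟩ : ∃ y, t = y + 1 := ⟨t - 1, by omega⟩
  obtain ⟨z, rfl⟩ : ∃ z, s₀ = z + 2 := ⟨s₀ - 2, by omega⟩
  obtain ⟨v, rfl⟩ : ∃ v, d = v + 3 := ⟨d - 3, by omega⟩
  have hv : v = y + z := by omega
  subst hv
  obtain ⟨u, rfl⟩ : ∃ u, a = y + z + 3 + 1 + u := ⟨a - (y + z + 3 + 1), by omega⟩
  obtain ⟨g, rfl⟩ : ∃ g, j = u + 1 + g := ⟨j - (u + 1), by omega⟩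
  obtain ⟨c, rfl⟩ : ∃ c, k = 3 * (y + z + 3 + 1 + u) + (u + 1 + g) + c :=
    ⟨k - (3 * (y + z + 3 + 1 + u) + (u + 1 + g)), by omega⟩
  have hj : g + 2 ≤ y + z := by omega
  have e1 : 3 * (y + z + 3 + 1 + u) + (u + 1 + g) + c - 1 - 1 - (y + z + 3 + (u + 1 + g)) =
      2 * y + 2 * z + 7 + 3 * u + c := by omega
  have e2 : y + z + 3 + (u + 1 + g) - (y + z + 3 + 1 + u) = g := by omega
  have e3 : y + z + 3 + 1 + u - 1 = y + z + 3 + u := by omega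
  have e4 : 3 * (y + z + 3 + 1 + u) + (u + 1 + g) + c - 1 = 3 * y + 3 * z + 12 + 4 * u + g + c := by omega
  have e6 : 3 * (y + z + 3 + 1 + u) + (u + 1 + g) + c - (y + z + 3 + 1 + u) - (z + 2) =
      2 * y + z + 7 + 3 * u + g + c := by omega
  have e7' : z + 2 - 1 = z + 1 := by omega
  have e7'' : y + z + 3 + 1 + u + 1 - (y + 1) = z + 4 + u := by omega
  have e8 : 3 * (y + z + 3 + 1 + u) + (u + 1 + g) + c - 1 - (y + z + 3 + 1 + u + (u + 1 + g)) =
      2 * y + 2 * z + 7 + 2 * u + c := by omega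
  have e9 : 3 * (y + z + 3 + 1 + u) + (u + 1 + g) + c - (y + z + 3 + 1 + u) - 3 =
      2 * y + 2 * z + 6 + 3 * u + g + c := by omega
  have e10 : y + z + 3 + 1 + u - 2 = y + z + 2 + u := by omega
  have e11 : 3 * (y + z + 3 + 1 + u) + (u + 1 + g) + c - (y + z + 3 + 1 + u) =
      2 * y + 2 * z + 9 + 3 * u + g + c := by omega
  rw [e1, e2, e3, e4] at hST
  rw [e6, e7', e7''] at hST
  rw [e8, e9, e10]
  rw [e11] at hmd
  have hyz : y ≤ y + z := by omega
  have h1 : y * y ≤ y * (y + z) := Nat.mul_le_mul_left _ hyz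
  have h2 : c * y ≤ c * (y + z) := Nat.mul_le_mul_left _ hyz
  have h3 : u * y ≤ u * (y + z) := Nat.mul_le_mul_left _ hyz
  have h4 : g * y ≤ g * (y + z) := Nat.mul_le_mul_left _ hyz
  linarith only [hST, hmd, hj, h1, h2, h3, h4, Nat.zero_le (u * g), Nat.zero_le (u * z), Nat.zero_le (z * c),
    Nat.zero_le (z * z), Nat.zero_le (y * z), Nat.zero_le (g * z)]

end C047

end TriangleCap

end PercRepro
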